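import Summits.Schanuel.Schanuel.Theorems.DiophantineDichotomyApproximationPropertyBoxModIdeal
import Mathlib.Combinatorics.Pigeonhole
import HarnessLib

/-!
# The avoiding box principle, part I: lattice points in translates of subspaces and the pigeonhole with multiplicity

Crux `Summit.Schanuel.Schanuel.Theses.DiophantineDichotomy.ApproximationProperty`
(stmt-Schanuel-6117), line `orbit-interpolation-determinant`, stub `stub_boxAvoiding` (file
`DiophantineDichotomyApproximationPropertyBoxAvoiding.lean`): Dirichlet's box principle for a form
of degree `b` in `m + 1` variables which AVOIDS finitely many `ℚ`-subspaces of large codimension.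
This helper file carries the three ingredients that are not in the template
`boxPrinciple_modIdeal` (`…BoxModIdeal.lean`):

* `BoxAvoiding.card_filter_sub_mem_le` — a translate `q₀ + V` of a subspace `V ⊆ ℚ^ι` of
  dimension `≤ d` contains at most `(N+1)^d` lattice points `q ∈ {0, …, N}^ι` (induction on `d`:
  slice by a coordinate that does not vanish on `V`);
* `BoxAvoiding.box_principle_complex_avoiding` — the box principle for ONE complex linear form
  `Λ(p) = ∑ p_j a_j` with the pigeons counted WITH MULTIPLICITY
  (`Finset.exists_lt_card_fiber_of_mul_lt_card_of_maps_to`): if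
  `k² (#G (P+1)^r + 1) < (P+1)^{#κ}` then some cell of the `k × k` grid on the value square holds
  more than `#G (P+1)^r + 1` tuples `0 ≤ q_j ≤ P`, hence two, `q ≠ q₀`, whose difference
  `p = q − q₀` lies in NO member of the finite family `G` of subspaces of `ℚ^κ` of dimension `≤ r`,
  and `|Λ(p)| ≤ 2(2 #κ A P + 1)/k` as in `Waldschmidt1981.box_principle_complex`;
* `BoxAvoiding.final_bound` — the arithmetic of `BoxModIdeal.final_bound` with the exponent
  `E = ⌊(M − L − 1)/2⌋` in place of `⌊(#B − 1)/2⌋`: the smallness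
  `exp((3 + m + log A₀)(b+1) − ((M − L − 4)/2) log(N+1))`.

Proofs only: no definitions, no named facts. Sources: M. Waldschmidt, Invent. Math. 63 (1981) §3
(box principle); Nesterenko–Philippon (eds.), LNM 1752 (2001), Ch. 3 §4.
-/

set_option linter.dupNamespace false

noncomputable section

namespace Summit.Schanuel.Schanuel.Cruxes.ApproximationProperty.OrbitInterpolationDeterminant

open Module Finset
open scoped BigOperators

namespace BoxAvoiding

/-! ## Lattice points in a translate of a subspace -/

open scoped Classical in
/-- **Lattice points in a translate of a subspace.** For a subspace `V ⊆ ℚ^ι` of dimension `≤ d`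
and any `q₀ ∈ ℚ^ι`, at most `(N+1)^d` of the lattice points `q ∈ {0, …, N}^ι` satisfy
`q − q₀ ∈ V` (induction on `d`: if `V ≠ 0` some coordinate `x_i` does not vanish on `V`; the
points with a fixed value of `q_i` differ by elements of `V ∩ {x_i = 0}`, of dimension `≤ d − 1`,
and `q_i` takes `N + 1` values). [folklore] -/
theorem card_filter_sub_mem_le {ι : Type*} [Fintype ι] [DecidableEq ι] (N : ℕ) :
    ∀ (d : ℕ) (V : Submodule ℚ (ι → ℚ)) (q₀ : ι → ℚ), finrank ℚ V ≤ d →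
      #{q : ι → Fin (N + 1) | (fun i => ((q i : ℕ) : ℚ)) - q₀ ∈ V} ≤ (N + 1) ^ d := by
  -- at most one lattice point in a translate of the zero subspace
  have hbot : ∀ (V : Submodule ℚ (ι → ℚ)) (q₀ : ι → ℚ), V = ⊥ →
      #{q : ι → Fin (N + 1) | (fun i => ((q i : ℕ) : ℚ)) - q₀ ∈ V} ≤ 1 := by
    intro V q₀ hV
    refine Finset.card_le_one.mpr fun q hq q' hq' => ?_
    rw [Finset.mem_filter, hV, Submodule.mem_bot, sub_eq_zero] at hq hq'
    funext i
    have h := congr_fun (hq.2.trans hq'.2.symm) i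
    exact Fin.ext (by exact_mod_cast h)
  intro d
  induction d with
  | zero =>
    intro V q₀ hd
    exact (hbot V q₀ (Submodule.finrank_eq_zero.mp (Nat.le_zero.mp hd))).trans (by simp)
  | succ d ih =>
    intro V q₀ hd
    by_cases hV : V = ⊥
    · exact (hbot V q₀ hV).trans (Nat.one_le_pow _ _ (Nat.succ_pos N))
    · obtain ⟨v, hvV, hv0⟩ := (Submodule.ne_bot_iff V).mp hV
      obtain ⟨i, hi⟩ := Function.ne_iff.mp hv0
      -- the slice `V' = V ∩ {x_i = 0}` has smaller dimension
      set V' : Submodule ℚ (ι → ℚ) := V ⊓ LinearMap.ker (LinearMap.proj i) with hV'def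
      have hV'd : finrank ℚ V' ≤ d := by
        have hlt : V' < V := by
          refine lt_of_le_of_ne inf_le_left fun h => hi ?_
          have hv' : v ∈ V' := by rw [h]; exact hvV
          exact hv'.2
        have := Submodule.finrank_lt_finrank_of_lt hlt
        omega
      calc #{q : ι → Fin (N + 1) | (fun i => ((q i : ℕ) : ℚ)) - q₀ ∈ V}
          ≤ (N + 1) ^ d * #(Finset.univ : Finset (Fin (N + 1))) := by
            refine Finset.card_le_mul_card_image_of_maps_to (f := fun q => q i)
              (fun _ _ => Finset.mem_univ _) _ fun t _ => ?_
            rcases ({q ∈ ({q : ι → Fin (N + 1) | (fun i => ((q i : ℕ) : ℚ)) - q₀ ∈ V} :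
                Finset (ι → Fin (N + 1))) | q i = t} : Finset _).eq_empty_or_nonempty with
                h | ⟨q₁, hq₁⟩
            · rw [h, Finset.card_empty]; exact Nat.zero_le _
            · -- the fibre over `t` lies in a translate of `V'`
              rw [Finset.mem_filter, Finset.mem_filter] at hq₁
              refine le_trans (Finset.card_le_card ?_) (ih V' (fun i => ((q₁ i : ℕ) : ℚ)) hV'd)
              intro q hq
              rw [Finset.mem_filter, Finset.mem_filter] at hq
              refine Finset.mem_filter.mpr ⟨Finset.mem_univ _, Submodule.mem_inf.mpr ⟨?_, ?_⟩⟩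
              · have := V.sub_mem hq.1.2 hq₁.1.2
                rwa [sub_sub_sub_cancel_right] at this
              · rw [LinearMap.mem_ker, LinearMap.proj_apply, Pi.sub_apply, hq.2, hq₁.2, sub_self]
        _ = (N + 1) ^ (d + 1) := by rw [Finset.card_univ, Fintype.card_fin, pow_succ]

/-! ## The box principle with multiplicity, avoiding finitely many subspaces -/

/-- **The avoiding box principle for one complex linear form.** Let `a_j` (`j ∈ κ`) be complex
numbers with `‖a_j‖ ≤ A`, `P`, `k ≥ 1`, `r` integers and `G` a finite family of `ℚ`-subspaces of
`ℚ^κ`, each of dimension `≤ r`, with `k² (#G (P+1)^r + 1) < (P+1)^{#κ}`. Then there are rational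
integers `p_j`, not all zero, `|p_j| ≤ P`, such that the vector `(p_j)` lies in NO member of `G`
and `|∑_j p_j a_j| ≤ 2(2 #κ A P + 1)/k`. (Pigeonhole with multiplicity on the `(P+1)^{#κ}` tuples
`0 ≤ q_j ≤ P` over the `k²` cells of the value square: a cell with more than `#G (P+1)^r + 1`
tuples contains, for any of its tuples `q₀`, some `q ≠ q₀` with `q − q₀ ∉ V` for all `V ∈ G`, by
`card_filter_sub_mem_le`.) [folklore] -/
theorem box_principle_complex_avoiding {κ : Type*} [Fintype κ] [DecidableEq κ]
    (a : κ → ℂ) {A : ℝ} (hA0 : 0 ≤ A) (hA : ∀ j, ‖a j‖ ≤ A) (P k r : ℕ) (hk : 0 < k)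
    (G : Finset (Submodule ℚ (κ → ℚ))) (hG : ∀ V ∈ G, finrank ℚ V ≤ r)
    (hcard : k ^ 2 * (G.card * (P + 1) ^ r + 1) < (P + 1) ^ Fintype.card κ) :
    ∃ p : κ → ℤ, p ≠ 0 ∧ (∀ j, |p j| ≤ P) ∧ (∀ V ∈ G, (fun j => (p j : ℚ)) ∉ V) ∧
      ‖∑ j, (p j : ℂ) * a j‖ ≤ 2 * ((2 * Fintype.card κ * A * P + 1) / k) := by
  classical
  set B : ℝ := Fintype.card κ * A * P with hB
  have hB0 : 0 ≤ B := by positivity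
  have hk0 : (0 : ℝ) < k := Nat.cast_pos.mpr hk
  set δ : ℝ := (2 * B + 1) / k with hδ
  have hδ0 : 0 < δ := by positivity
  have hkδ : (k : ℝ) * δ = 2 * B + 1 := by rw [hδ]; field_simp
  -- the linear form at the lattice points `0 ≤ q_j ≤ P`
  set L : (κ → Fin (P + 1)) → ℂ := fun q => ∑ j, ((q j : ℕ) : ℂ) * a j with hL
  have hLB : ∀ q, ‖L q‖ ≤ B := by
    intro q
    calc ‖L q‖ ≤ ∑ j, ‖((q j : ℕ) : ℂ) * a j‖ := norm_sum_le _ _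
      _ ≤ ∑ _j : κ, (P : ℝ) * A := Finset.sum_le_sum fun j _ => by
          rw [norm_mul, Complex.norm_natCast]
          have hq : ((q j : ℕ) : ℝ) ≤ P := by exact_mod_cast Nat.lt_succ_iff.mp (q j).isLt
          exact mul_le_mul hq (hA j) (norm_nonneg _) (Nat.cast_nonneg _)
      _ = B := by rw [Finset.sum_const, Finset.card_univ, nsmul_eq_mul, hB]; ring
  have hre : ∀ q, |(L q).re| ≤ B := fun q => (Complex.abs_re_le_norm _).trans (hLB q)
  have him : ∀ q, |(L q).im| ≤ B := fun q => (Complex.abs_im_le_norm _).trans (hLB q)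
  -- the cells of the value square
  set box : (κ → Fin (P + 1)) → ℕ × ℕ := fun q =>
    (⌊((L q).re + B) / δ⌋₊, ⌊((L q).im + B) / δ⌋₊) with hbox
  have hcell : ∀ x : ℝ, |x| ≤ B → ⌊(x + B) / δ⌋₊ < k := by
    intro x hx
    have hnn : 0 ≤ (x + B) / δ := div_nonneg (by have := (abs_le.mp hx).1; linarith) hδ0.le
    rw [Nat.floor_lt hnn, div_lt_iff₀ hδ0, hkδ]
    have := (abs_le.mp hx).2
    linarith
  have hmaps : ∀ q ∈ (Finset.univ : Finset (κ → Fin (P + 1))),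
      box q ∈ Finset.range k ×ˢ Finset.range k := by
    intro q _
    rw [Finset.mem_product, Finset.mem_range, Finset.mem_range]
    exact ⟨hcell _ (hre q), hcell _ (him q)⟩
  have hcard' : (Finset.range k ×ˢ Finset.range k).card * (G.card * (P + 1) ^ r + 1) <
      (Finset.univ : Finset (κ → Fin (P + 1))).card := by
    rw [Finset.card_product, Finset.card_range, Finset.card_univ, Fintype.card_pi,
      Finset.prod_const, Fintype.card_fin, Finset.card_univ, ← sq]
    exact hcard
  -- pigeonhole with multiplicity: a crowded cell `S`, a base point `q₀ ∈ S`
  obtain ⟨y, -, hy⟩ := Finset.exists_lt_card_fiber_of_mul_lt_card_of_maps_to hmaps hcard'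
  set S : Finset (κ → Fin (P + 1)) := {q ∈ (Finset.univ : Finset (κ → Fin (P + 1))) | box q = y}
    with hS
  have hSne : S.Nonempty := by rw [← Finset.card_pos]; omega
  obtain ⟨q₀, hq₀⟩ := hSne
  -- the bad points of the cell: those in `q₀ + V` for some `V ∈ G`
  set bad : Finset (κ → Fin (P + 1)) := S.filter fun q =>
    ∃ V ∈ G, ((fun j => ((q j : ℕ) : ℚ)) - fun j => ((q₀ j : ℕ) : ℚ)) ∈ V with hbad
  have hbadcard : bad.card ≤ G.card * (P + 1) ^ r := by
    calc bad.card ≤ (G.biUnion fun V => S.filter fun q =>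
          ((fun j => ((q j : ℕ) : ℚ)) - fun j => ((q₀ j : ℕ) : ℚ)) ∈ V).card := by
          refine Finset.card_le_card fun q hq => ?_
          rw [hbad, Finset.mem_filter] at hq
          obtain ⟨hqS, V, hVG, hqV⟩ := hq
          exact Finset.mem_biUnion.mpr ⟨V, hVG, Finset.mem_filter.mpr ⟨hqS, hqV⟩⟩
      _ ≤ ∑ V ∈ G, (S.filter fun q =>
          ((fun j => ((q j : ℕ) : ℚ)) - fun j => ((q₀ j : ℕ) : ℚ)) ∈ V).card :=
          Finset.card_biUnion_le
      _ ≤ ∑ _V ∈ G, (P + 1) ^ r := by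
          refine Finset.sum_le_sum fun V hV => ?_
          refine le_trans (Finset.card_le_card fun q hq => ?_)
            (card_filter_sub_mem_le P r V (fun j => ((q₀ j : ℕ) : ℚ)) (hG V hV))
          rw [Finset.mem_filter] at hq ⊢
          exact ⟨Finset.mem_univ _, hq.2⟩
      _ = G.card * (P + 1) ^ r := by rw [Finset.sum_const, smul_eq_mul]
  -- a good point `q ≠ q₀` of the cell
  obtain ⟨q, hq, hne⟩ : ∃ q ∈ S \ bad, q ≠ q₀ := by
    have h2 : 1 < (S \ bad).card := by
      have := Finset.le_card_sdiff bad S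
      omega
    obtain ⟨q₁, hq₁, q₂, hq₂, h12⟩ := Finset.one_lt_card.mp h2
    by_cases h : q₁ = q₀
    · exact ⟨q₂, hq₂, fun h' => h12 (h.trans h'.symm)⟩
    · exact ⟨q₁, hq₁, h⟩
  rw [Finset.mem_sdiff] at hq
  obtain ⟨hqS, hqbad⟩ := hq
  refine ⟨fun j => ((q j : ℕ) : ℤ) - ((q₀ j : ℕ) : ℤ), ?_, ?_, ?_, ?_⟩
  · intro h0
    apply hne
    funext j
    have hj := congr_fun h0 j
    simp only [Pi.zero_apply, sub_eq_zero, Nat.cast_inj] at hj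
    exact Fin.ext hj
  · intro j
    have h1 : ((q j : ℕ) : ℤ) ≤ P := by exact_mod_cast Nat.lt_succ_iff.mp (q j).isLt
    have h2 : ((q₀ j : ℕ) : ℤ) ≤ P := by exact_mod_cast Nat.lt_succ_iff.mp (q₀ j).isLt
    have h3 : (0 : ℤ) ≤ ((q j : ℕ) : ℤ) := by positivity
    have h4 : (0 : ℤ) ≤ ((q₀ j : ℕ) : ℤ) := by positivity
    rw [abs_le]
    constructor <;> linarith
  · intro V hV hpV
    refine hqbad (Finset.mem_filter.mpr ⟨hqS, V, hV, ?_⟩)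
    convert hpV using 1
    funext j
    push_cast
    rfl
  · have hdiff :
        ∑ j, (((((q j : ℕ) : ℤ) - ((q₀ j : ℕ) : ℤ) : ℤ)) : ℂ) * a j = L q - L q₀ := by
      simp only [hL, Int.cast_sub, Int.cast_natCast, sub_mul, Finset.sum_sub_distrib]
    rw [hdiff]
    have hbq : box q = box q₀ := by
      rw [hS, Finset.mem_filter] at hqS hq₀
      rw [hqS.2, hq₀.2]
    -- two points of one cell
    have hco : ∀ u v : ℝ, |u| ≤ B → |v| ≤ B → ⌊(u + B) / δ⌋₊ = ⌊(v + B) / δ⌋₊ →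
        |u - v| ≤ δ := by
      intro u v hu hv huv
      have hu' : 0 ≤ (u + B) / δ := div_nonneg (by have := (abs_le.mp hu).1; linarith) hδ0.le
      have hv' : 0 ≤ (v + B) / δ := div_nonneg (by have := (abs_le.mp hv).1; linarith) hδ0.le
      have hlt := Literature.NumberTheory.Transcendental.Waldschmidt1981.abs_sub_lt_one_of_floor_eq
        hu' hv' huv
      rw [← sub_div, abs_div, abs_of_pos hδ0, div_lt_one hδ0] at hlt
      have : u + B - (v + B) = u - v := by ring
      rw [this] at hlt
      exact hlt.le
    have h1 : |(L q - L q₀).re| ≤ δ := by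
      rw [Complex.sub_re]; exact hco _ _ (hre q) (hre q₀) (congr_arg Prod.fst hbq)
    have h2 : |(L q - L q₀).im| ≤ δ := by
      rw [Complex.sub_im]; exact hco _ _ (him q) (him q₀) (congr_arg Prod.snd hbq)
    have hε : (2 * (Fintype.card κ : ℝ) * A * P + 1) / k = δ := by rw [hδ, hB]; ring
    rw [hε]
    calc ‖L q - L q₀‖ ≤ |(L q - L q₀).re| + |(L q - L q₀).im| :=
          Complex.norm_le_abs_re_add_abs_im _
      _ ≤ δ + δ := add_le_add h1 h2
      _ = 2 * δ := by ring

/-! ## Arithmetic -/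

/-- **The final estimate of the avoiding box principle.** With `A₀ ≥ 1`, `N ≥ 1`,
`L + 4 ≤ M ≤ #B ≤ 2^{b+m}`, `E = ⌊(M − L − 1)/2⌋`, `k = (N+1)^E`: a quantity
`V ≤ 2(2 #B A₀^b N + 1)/k` satisfies
`V ≤ exp((3 + m + log A₀)(b+1) − ((M − L − 4)/2) log(N+1))` (the arithmetic of
`BoxModIdeal.final_bound`, with `2E ≥ M − L − 2`). [folklore] -/
theorem final_bound {A₀ V : ℝ} {m b N M L card E k : ℕ} (hA₀ : 1 ≤ A₀) (hN : 1 ≤ N)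
    (hLM : L + 4 ≤ M) (hMc : M ≤ card) (hcard : card ≤ 2 ^ (b + m)) (hE : E = (M - L - 1) / 2)
    (hk : k = (N + 1) ^ E)
    (hV : V ≤ 2 * ((2 * (card : ℕ) * A₀ ^ b * N + 1) / k)) :
    V ≤ Real.exp ((3 + m + Real.log A₀) * (b + 1) -
      ((M : ℝ) - L - 4) / 2 * Real.log ((N : ℝ) + 1)) := by
  have hA : 1 ≤ A₀ ^ b := one_le_pow₀ hA₀
  have hN' : (1 : ℝ) ≤ N := by exact_mod_cast hN
  have hc4 : (4 : ℝ) ≤ card := by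
    have h : 4 ≤ card := by omega
    exact_mod_cast h
  have hk0 : (0 : ℝ) < k := by rw [hk]; positivity
  have hkR : (k : ℝ) = ((N : ℝ) + 1) ^ E := by rw [hk]; push_cast; ring
  -- `E ≥ (M - L - 2)/2`
  have hE' : ((M : ℝ) - L - 2) / 2 ≤ E := by
    have h1 : 2 * E + (M - L - 1) % 2 = M - L - 1 := by rw [hE]; exact Nat.div_add_mod _ 2
    have h2 : (M - L - 1) % 2 < 2 := Nat.mod_lt _ (by norm_num)
    have h3 : M - L - 2 ≤ 2 * E := by omega
    have h4 : ((M : ℕ) : ℝ) - L - 2 ≤ 2 * (E : ℝ) := by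
      have : ((M - L - 2 : ℕ) : ℝ) = (M : ℝ) - L - 2 := by
        rw [Nat.cast_sub (by omega), Nat.cast_sub (by omega)]; norm_num
      rw [← this]; exact_mod_cast h3
    linarith
  -- step 1: `V ≤ 6 #B A₀^b (N+1) / k`
  have h1 : V ≤ 6 * card * A₀ ^ b * (((N : ℝ) + 1) / k) := by
    have hX : (1 : ℝ) ≤ card * A₀ ^ b * N :=
      one_le_mul_of_one_le_of_one_le (one_le_mul_of_one_le_of_one_le (by linarith) hA) hN'
    have h11 : 2 * (card : ℝ) * A₀ ^ b * N + 1 ≤ 3 * card * A₀ ^ b * ((N : ℝ) + 1) := by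
      have h12 : 3 * ((card : ℝ) * A₀ ^ b * N) ≤ 3 * (card * A₀ ^ b * ((N : ℝ) + 1)) := by
        gcongr; linarith
      linarith
    calc V ≤ 2 * ((2 * (card : ℝ) * A₀ ^ b * N + 1) / k) := hV
      _ ≤ 2 * ((3 * card * A₀ ^ b * ((N : ℝ) + 1)) / k) := by gcongr
      _ = 6 * card * A₀ ^ b * (((N : ℝ) + 1) / k) := by ring
  -- step 2: `(N+1)/k ≤ exp(−((M−L−4)/2) log(N+1))`
  have hlogN : 0 ≤ Real.log ((N : ℝ) + 1) := Real.log_nonneg (by linarith)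
  have h2 : ((N : ℝ) + 1) / k ≤
      Real.exp (-(((M : ℝ) - L - 4) / 2) * Real.log ((N : ℝ) + 1)) := by
    have hN1 : (0 : ℝ) < (N : ℝ) + 1 := by linarith
    have e1 : ((N : ℝ) + 1) / k = Real.exp ((1 - (E : ℝ)) * Real.log ((N : ℝ) + 1)) := by
      rw [sub_mul, one_mul, Real.exp_sub, Real.exp_log hN1, hkR, ← Real.log_pow,
        Real.exp_log (by positivity)]
    rw [e1]
    refine Real.exp_le_exp.mpr (mul_le_mul_of_nonneg_right ?_ hlogN)
    linarith
  -- step 3: `6 #B A₀^b ≤ exp((3 + m + log A₀)(b+1))`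
  have h3 : 6 * (card : ℝ) * A₀ ^ b ≤ Real.exp ((3 + m + Real.log A₀) * (b + 1)) := by
    have hlogA : 0 ≤ Real.log A₀ := Real.log_nonneg hA₀
    have hcpos : (0 : ℝ) < card := by linarith
    have e : 6 * (card : ℝ) * A₀ ^ b =
        Real.exp (Real.log 6 + Real.log card + b * Real.log A₀) := by
      rw [Real.exp_add, Real.exp_add, Real.exp_log (by norm_num), Real.exp_log hcpos,
        ← Real.log_pow, Real.exp_log (by positivity)]
    rw [e]
    refine Real.exp_le_exp.mpr ?_
    have hlc : Real.log card ≤ b + m := by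
      calc Real.log card ≤ Real.log ((2 : ℝ) ^ (b + m)) :=
            Real.log_le_log hcpos (by exact_mod_cast hcard)
        _ ≤ (b + m : ℕ) := BoxModIdeal.log_two_pow_le _
        _ = b + m := by push_cast; ring
    have hb : (0 : ℝ) ≤ b := Nat.cast_nonneg b
    have hm : (0 : ℝ) ≤ m := Nat.cast_nonneg m
    have hexp : (3 + (m : ℝ) + Real.log A₀) * (b + 1) =
        3 * b + 3 + m * b + m + b * Real.log A₀ + Real.log A₀ := by ring
    rw [hexp]
    have hlog6 : Real.log 6 ≤ 2 := by
      have h6 : (6 : ℝ) ≤ Real.exp 2 := by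
        have he : (2.7182818283 : ℝ) < Real.exp 1 := Real.exp_one_gt_d9
        have h2 : Real.exp 2 = Real.exp 1 * Real.exp 1 := by rw [← Real.exp_add]; norm_num
        nlinarith [Real.exp_pos 1]
      calc Real.log 6 ≤ Real.log (Real.exp 2) := Real.log_le_log (by norm_num) h6
        _ = 2 := Real.log_exp 2
    have hmb : 0 ≤ (m : ℝ) * b := mul_nonneg hm hb
    linarith
  -- assembly
  calc V ≤ 6 * card * A₀ ^ b * (((N : ℝ) + 1) / k) := h1
    _ ≤ Real.exp ((3 + m + Real.log A₀) * (b + 1)) *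
          Real.exp (-(((M : ℝ) - L - 4) / 2) * Real.log ((N : ℝ) + 1)) :=
        mul_le_mul h3 h2 (by positivity) (by positivity)
    _ = _ := by rw [← Real.exp_add]; ring_nf

end BoxAvoiding

/-- **Registered helper stub `stub_boxAvoiding_lemmas`** (anchor of this helper file on the crux
item): the final estimate `BoxAvoiding.final_bound`, uncurried. [folklore] -/
theorem stub_boxAvoiding_lemmas : ∀ (A₀ V : ℝ) (m b N M L card E k : ℕ), 1 ≤ A₀ → 1 ≤ N → L + 4 ≤ M → M ≤ card → card ≤ 2 ^ (b + m) → E = (M - L - 1) / 2 → k = (N + 1) ^ E → V ≤ 2 * ((2 * (card : ℝ) * A₀ ^ b * N + 1) / k) → V ≤ Real.exp ((3 + m + Real.log A₀) * (b + 1) - ((M : ℝ) - L - 4) / 2 * Real.log ((N : ℝ) + 1)) :=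
  fun _ _ _ _ _ _ _ _ _ _ hA₀ hN hLM hMc hcard hE hk hV =>
    BoxAvoiding.final_bound hA₀ hN hLM hMc hcard hE hk hV

end Summit.Schanuel.Schanuel.Cruxes.ApproximationProperty.OrbitInterpolationDeterminant

end
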